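import Literature.Computability.Complexity.ArthurMerlinGames
import Literature.Computability.Complexity.ReductionsProofs
import Literature.Computability.Complexity.BrickAlgebra
import HarnessLib

/-!
# Merlin–Arthur protocols with advice at a time scale: the promise form
# (Murray–Williams 2018, §2 and Def. 2.1)

The Merlin–Arthur upper bound of Murray–Williams 2018, Thm. 3.1 (C. D. Murray, R. R. Williams,
*Circuit lower bounds for nondeterministic quasi-polytime: an easy witness lemma for NP and NQP*,
STOC 2018 / ECCC TR17-188) reads: "there is a language `L₁` computable by a Merlin–Arthur
protocol in `O(s₁(n)² · s₂(n)^{d₃})` time with `2 log s₂(n)` advice, such that …", with the two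
conventions of §2: advice classes — "for a deterministic or nondeterministic class `𝒞` and a
function `a(n)`, `𝒞/a(n)` is the class of languages `L` such that there is an `L' ∈ 𝒞` and an
arbitrary function `f : ℕ → {0,1}*` with `|f(n)| ≤ a(n)` for all `x`, `x ∈ L ⟺ (x, f(|x|)) ∈ L'`.
That is, the arbitrary advice string `f(n)` can be used to solve all `n`-bit instances within
class `𝒞`" — and, for the promise class `MA`, Definition 2.1: "a Merlin–Arthur protocol `P`
satisfies the MA promise on length `ℓ` if for all `x ∈ {0,1}^ℓ`, either there is a Merlin message
such that Arthur accepts `x` with probability at least `2/3`, or for all Merlin messages, Arthur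
rejects `x` with probability at least `2/3`", the protocol of Thm. 3.1 being shown to satisfy the
promise on all lengths WHEN RUN WITH THE CORRECT ADVICE ("the advice `αₙ` ensures that `M₁`
satisfies the MA promise on all input lengths"). No such class exists in the tree: its
Arthur–Merlin classes (`ArthurMerlinGames.lean`: `AMGames`, `MA = MA(2)`) have a polynomial-time
referee, moves of POLYNOMIAL length and no advice, and the advice operator `polyAdvice`
(`CircuitClasses.lean`) applied to `MA` would demand the promise for EVERY advice string (the
classical pitfall of `MA/1`).

This file defines the class these statements live in, over the tree's game values
(`amValue`, Babai–Moran): **`MAPromiseAdvice m a`** — languages `L` for which there are a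
polynomial-time referee `Ref`, and advice strings `adv n` of length `≤ a n`, such that on every
input `x`, in the two-move game `[merlin, arthur]` with moves of length `m |x|` played on
`⟨x, adv |x|⟩`, Merlin's winning chance is `≥ 2/3` if `x ∈ L` and `≤ 1/3` if `x ∉ L`. The
move length `m` is an ARBITRARY function: it is the time scale — Merlin's message (a circuit of
size `s₁(n)`) and Arthur's coins have length `m(n)`, and the referee, polynomial-time in its own
input `⟨⟨x, adv⟩, moves⟩` of length `Θ(|x| + a(|x|) + m(|x|))`, runs in time `poly(m(n))` for
`m(n) ≥ n`; so "computable by a Merlin–Arthur protocol in `T(n)^{O(1)}` time with `a(n)` advice,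
promise on all lengths" is membership in `MAPromiseAdvice T a`. (The exact polynomial is
immaterial to Murray–Williams' argument, whose constant `d` is chosen after the protocol.)

* `MAPromiseAdvice m a`, `mem_MAPromiseAdvice_iff`;
* `MAPromiseAdvice_mono` — more advice allowed, same class or larger;
* `amValue_preimage_fstF_of_mem/_of_not_mem` — a referee reading only `x` out of
  `⟨⟨x, adv⟩, moves⟩` has the constant game value `[x ∈ L]`; hence **`P_subset_MAPromiseAdvice`**: `P ⊆ MAPromiseAdvice m a`
  for all `m`, `a` (non-vacuity; the deterministic referee ignores Merlin, coins and advice).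

Definitions with bodies and theorems only; no named fact is introduced.

## References

* C. D. Murray, R. R. Williams, *Circuit lower bounds for nondeterministic quasi-polytime: an easy
  witness lemma for NP and NQP*, STOC 2018 (ECCC TR17-188), §2 ("We use advice classes …",
  Definition 2.1) and Thm. 3.1 [MurrayWilliams2018].
* L. Babai, S. Moran, *Arthur–Merlin games: a randomized proof system, and a hierarchy of
  complexity classes*, JCSS 36 (1988) 254–276, §2.3–2.4 [BabaiMoran1988].
* S. Arora, B. Barak, *Computational Complexity: A Modern Approach*, CUP 2009, Def. 8.10 (`MA`),
  Def. 6.16 (advice) [AroraBarakCC2009].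
-/

noncomputable section

namespace Literature.Computability.Complexity

open AMPlayer Brick

/-- **Merlin–Arthur protocols with advice `a` at move length `m`, promise form**
(Murray–Williams 2018, §2 advice classes and Def. 2.1): `L ∈ MAPromiseAdvice m a` iff there are
a referee `Ref ∈ P` and advice strings `adv n`, `|adv n| ≤ a n`, such that for every input `x`,
in the game `[merlin, arthur]` with moves in `{0,1}^{m |x|}` on the advised input `⟨x, adv |x|⟩`
(`amValue`), Merlin's winning chance is `≥ 2/3` if `x ∈ L` and `≤ 1/3` if `x ∉ L` — the promise
is required for the correct advice only, on all lengths. The referee runs in time polynomial in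
`|x| + a |x| + m |x|`: `m` is the time scale. [cite: MurrayWilliams2018, §2 (advice classes) and Definition 2.1] -/
def MAPromiseAdvice (m a : ℕ → ℕ) : Set (Language Bool) :=
  {L | ∃ Ref ∈ Classes.P, ∃ adv : ℕ → List Bool, (∀ n, (adv n).length ≤ a n) ∧
    ∀ x : List Bool,
      (x ∈ L → (2 / 3 : ℝ) ≤ amValue Ref (m x.length) [merlin, arthur] (boolPair x (adv x.length))) ∧
      (x ∉ L → amValue Ref (m x.length) [merlin, arthur] (boolPair x (adv x.length)) ≤ 1 / 3)}

/-- Unfolding lemma for `MAPromiseAdvice`. [cite: MurrayWilliams2018, Definition 2.1] -/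
theorem mem_MAPromiseAdvice_iff {m a : ℕ → ℕ} {L : Language Bool} :
    L ∈ MAPromiseAdvice m a ↔ ∃ Ref ∈ Classes.P, ∃ adv : ℕ → List Bool,
      (∀ n, (adv n).length ≤ a n) ∧ ∀ x : List Bool,
        (x ∈ L → (2 / 3 : ℝ) ≤
          amValue Ref (m x.length) [merlin, arthur] (boolPair x (adv x.length))) ∧
        (x ∉ L → amValue Ref (m x.length) [merlin, arthur] (boolPair x (adv x.length)) ≤ 1 / 3) :=
  Iff.rfl

/-- **Monotonicity in the advice bound**: a longer advice allowance gives the same class or a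
larger one (same referee, same advice). [cite: MurrayWilliams2018, §2 (advice classes)] -/
theorem MAPromiseAdvice_mono {m a a' : ℕ → ℕ} (h : ∀ n, a n ≤ a' n) :
    MAPromiseAdvice m a ⊆ MAPromiseAdvice m a' := by
  rintro L ⟨Ref, hRef, adv, hadv, hL⟩
  exact ⟨Ref, hRef, adv, fun n => (hadv n).trans (h n), hL⟩

/-- **A referee that only reads `x`**, members: for the referee `(fstF ∘ fstF)⁻¹' L`, which on
`⟨⟨x, adv⟩, moves⟩` decides `x ∈ L` and ignores advice and moves, every history has payoff `1`
when `x ∈ L`, so the game value on `⟨x, adv⟩` is `1`, for every pattern and move length.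
[cite: BabaiMoran1988, §2.3] -/
theorem amValue_preimage_fstF_of_mem {L : Language Bool} (m : ℕ) (pat : List AMPlayer)
    {x : List Bool} (hx : x ∈ L) (adv : List Bool) :
    amValue ((fstF ∘ fstF) ⁻¹' L) m pat (boolPair x adv) = 1 := by
  unfold amValue
  have hpay : refereePayoff ((fstF ∘ fstF) ⁻¹' L) (boolPair x adv) = fun _ => (1 : ℝ) := by
    funext h
    refine refereePayoff_of_mem ?_
    show fstF (fstF (boolPair (boolPair x adv) ((Computability.encodingList Bool).listBool.encode h))) ∈ L
    rwa [fstF_boolPair, fstF_boolPair]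
  rw [hpay, gameValue_const]

/-- **A referee that only reads `x`**, non-members: the game value on `⟨x, adv⟩` is `0` when
`x ∉ L`. [cite: BabaiMoran1988, §2.3] -/
theorem amValue_preimage_fstF_of_not_mem {L : Language Bool} (m : ℕ) (pat : List AMPlayer)
    {x : List Bool} (hx : x ∉ L) (adv : List Bool) :
    amValue ((fstF ∘ fstF) ⁻¹' L) m pat (boolPair x adv) = 0 := by
  unfold amValue
  have hpay : refereePayoff ((fstF ∘ fstF) ⁻¹' L) (boolPair x adv) = fun _ => (0 : ℝ) := by
    funext h
    refine refereePayoff_of_not_mem ?_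
    show fstF (fstF (boolPair (boolPair x adv) ((Computability.encodingList Bool).listBool.encode h))) ∉ L
    rwa [fstF_boolPair, fstF_boolPair]
  rw [hpay, gameValue_const]

/-- **`P ⊆ MAPromiseAdvice m a`** for every move length `m` and advice bound `a`
(non-vacuity): for `L ∈ P` take the referee `(fstF ∘ fstF)⁻¹' L ∈ P` and empty advice; the game
value is `1` on members and `0` on non-members. [cite: AroraBarakCC2009, Def. 8.10] -/
theorem P_subset_MAPromiseAdvice (m a : ℕ → ℕ) : Classes.P ⊆ MAPromiseAdvice m a := by
  intro L hL
  refine ⟨(fstF ∘ fstF) ⁻¹' L, preimage_mem_P hL (comp_mem_FP fstF_mem_FP fstF_mem_FP),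
    fun _ => [], fun _ => by simp, fun x => ⟨fun hx => ?_, fun hx => ?_⟩⟩
  · rw [amValue_preimage_fstF_of_mem _ _ hx]
    norm_num
  · rw [amValue_preimage_fstF_of_not_mem _ _ hx]
    norm_num

end Literature.Computability.Complexity

end
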